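import Summits.AtomisticToContinuum.Crystallization.Theorems.ChartedZeroExcessLayeredLatticeLiouvilleXV

/-!
# Zero-excess layered lattice Liouville — part XW (lens-2 g59, node «SBGlueD»): ★ the leaf `SubWindowBudgetGlueBPG` is PROVED

Leaf (2) of `stmt-AtomisticToContinuum-26636` (critic rows 1051/1119/1125/1127/1133/1135, record A ✓ B ✓ C1 ✓ C2 ✓; C3 = XL, C4 = XM–XS, D = XT–XW):

★ `subWindowBudgetGlueBPG_holds : SubWindowBudgetGlueBPG tameRadius 1 2 3 (1/16) (1/50) (1/25) (1/2000) (1/1000)` — the nine structural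
antecedents (`TailDominationCert`, `LinearExcessDecayZ`, `HarmonicComparisonZ`, `LinearisationDefectP`, `EquilChartStrainP (1/25) 3 (1/1000)`,
`PairForceTaylorP`, `TailFluxBSP 1 3 (1/16) (1/25)`, `UniformTameStabilityE (1/50) 2 (1/2000)`, `EnergyNearChartPX 1 2 (1/16) (1/50) (1/2000)`) imply the
sub-window energy budget `SubWindowBudgetBPG tameRadius 1 2 (1/16) (1/50)` VERBATIM.  Assembly: the constants `Q : SBPre` are chosen from the first eight
antecedents (`SBPre.exists_pack`, XV) BEFORE `K₀, η, R`; `AB = Q.AB`, `ρ₀ = max(nlo, 21)`, `ϑ₁ = ω₁ = Q.ϑ₁`; `η₁ = min(η₁ᴱ, Q.η₁)`, `R₁ = max(R₁ᴱ, Q.R₁)` with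
`(η₁ᴱ, R₁ᴱ)` from `EnergyNearChartPX` (at the excess constant of `hasQuadExcess_of_isDoorSetPG`); for a door set `S`, a chart `(L, w)` and a registration
`Ψ`, energy-nearness feeds UTS (chart `0` of the tower: `st₀ = ⟨L, w, w', 0, 0⟩`), the scheme `Q.toK η R` satisfies `SBK.OK` (`SBPre.ok_toK`, XU), the tower
hypothesis `TH` holds at every `x ∈ S ∩ B(0, 8R)` with base index `X₀ = idxOf (Ψ x)`, and `TH.final` (XS) is the claim with `K.ABK = Q.AB·η` (`SBPre.ABK_toK`).
The hypotheses `K₀ ≤ η·#atoms(B_R)` and `IsTameOn` of `SubWindowBudgetBPG` are not used.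
-/

noncomputable section

open scoped BigOperators InnerProductSpace RealInnerProductSpace
open Set Function Metric
open Summit.AtomisticToContinuum.Crystallization.Theorems.ChartedPlanarOrderRigidityDoor (E3 IsClean IsNash atomsIn)
open Summit.AtomisticToContinuum.Crystallization.Theorems.ChartedPlanarOrderDensityDichotomy (μS IsSep nK nK_nonneg)
open Summit.AtomisticToContinuum.Crystallization.Theorems.ChartedPlanarOrderCleanScaleP (IsCleanP IsDoorSetP isCleanP_one_iff)
open Summit.AtomisticToContinuum.Crystallization.Theorems.ChartedPlanarOrderMesoCut (LayeredHom)
open Summit.AtomisticToContinuum.Crystallization.Theorems.ChartedPlanarOrderDoorLayered (Layered layeredHom_eq_layered atomsIn_subset)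
open Summit.AtomisticToContinuum.Crystallization.Theorems.ChartedPlanarOrderDoorLayeredOsc (IsTwoShellAffineGood)

namespace Summit.AtomisticToContinuum.Crystallization.Theorems.ChartedZeroExcessLayeredLatticeLiouville

/-- the tower hypothesis at a point of the window, from the packages of `Q` and the data of `SubWindowBudgetBPG`. -/
theorem SBPre.Pack.th {Q : SBPre} {δ η R : ℝ} (P : Q.Pack δ) (hK : (Q.toK η R).OK) {S : Set E3} (hdoorδ : IsDoorSetP 1 δ S)
    (hdoor : IsDoorSetP 1 Q.δ S) (haff : ∀ q ∈ S, IsTwoShellAffineGood (1 / 16) S q) {L : E3 ≃L[ℝ] E3} {w w' : ℤ → E3}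
    (hchart : IsEquilChart Q.a (1 / 50) 2 L w) (hnear : IsEnergyNear (1 / 2000) (LayeredHom (L : E3 →L[ℝ] E3) w))
    (hlay : Layered (chartGen₁ L) (chartGen₂ L) w' = LayeredHom (L : E3 →L[ℝ] E3) w)
    (hcr : IsLayeredCrystal Q.c₀ (chartGen₁ L) (chartGen₂ L) w') (htm : IsTameIndexing Q.C₁ (chartGen₁ L) (chartGen₂ L) w')
    (hco : CoerciveZ (layeredKernel (chartGen₁ L) (chartGen₂ L) w') Q.κ₀) {Ψ : E3 → E3}
    (hreg : IsGlobalReg Q.Cg η R S (LayeredHom (L : E3 →L[ℝ] E3) w) Ψ) (hiso : IsBondIso S Ψ)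
    (hcoh : IsCoherentBy Q.ϑ₁ Q.ϑ₁ S Ψ (atomsIn (μS S) 0 (9 * R))) {x : E3} (hx : x ∈ S) (hxR : ‖x‖ < 8 * R) :
    TH (Q.toK η R) S Ψ ⟨L, w, w', 0, 0⟩ x (idxOf (chartGen₁ L) (chartGen₂ L) w' (Ψ x)) := by
  have hbij : BijOn Ψ S (Layered (chartGen₁ L) (chartGen₂ L) w') := by rw [hlay]; exact hreg.1
  exact
    { ok := hK, door := hdoor, affine := haff, iso := hiso, reg := hreg, coh := hcoh, chart₀ := hchart, near₀ := hnear, lay₀ := hlay,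
      cryst₀ := hcr, tame₀ := htm, coer₀ := hco, D₀ := rfl, DM₀ := rfl, xS := hx, xR := hxR, hX₀ := atomOf_idxOf_apply hbij hx,
      lin := P.lin, CT := P.CT, HC := P.HC, LD := P.LD, TF := P.TF S hdoorδ haff, RC := P.RC }

/-- ★★ **the leaf `SubWindowBudgetGlueBPG` of `stmt-AtomisticToContinuum-26636` (2)** (module docstring). [this file, g59] -/
theorem subWindowBudgetGlueBPG_holds : SubWindowBudgetGlueBPG tameRadius 1 2 3 (1 / 16) (1 / 50) (1 / 25) (1 / 2000) (1 / 1000) := by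
  intro hTD hLD hHC hLin hRC hPFT hTF hUTS hEN δ hδ a ha Cg hCg
  obtain ⟨Q, hQδ, hQa, hQCg, P⟩ := SBPre.exists_pack hTD hLD hHC hLin hRC hPFT hTF hUTS hδ ha hCg
  have hQ := P.ok
  obtain ⟨C₁q, hC₁q0, hC₁q⟩ := hasQuadExcess_of_isDoorSetPG hδ
  obtain ⟨η₁E, hη₁E, R₁E, hR₁E, hENall⟩ := hEN δ hδ a ha C₁q hC₁q0 Cg hCg
  have hnlo := hQ.hnlo
  refine ⟨Q.AB, SBPre.AB_nonneg hQ, max Q.nlo 21, lt_max_of_lt_right (by norm_num), Q.ϑ₁, SBPre.ϑ₁_pos hQ, Q.ϑ₁, SBPre.ϑ₁_pos hQ,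
    fun K₀ _ => ⟨min η₁E Q.η₁, lt_min hη₁E (SBPre.η₁_pos hQ), max R₁E Q.R₁, lt_max_of_lt_left hR₁E, ?_⟩⟩
  intro S hdoorPG haff η hη hηle R hRle L w hchart Ψ hreg hiso _ _ hcoh x hx ρ hρ hsub
  have hdoorP : IsDoorSetP 1 δ S := hdoorPG.isDoorSetP
  have hdoorQ : IsDoorSetP 1 Q.δ S := by
    rw [hQδ]
    exact ⟨hdoorP.1, fun p hp q hq hpq => (min_le_left δ 1).trans (hdoorP.2.1 p hp q hq hpq), hdoorP.2.2⟩
  have hnear : IsEnergyNear (1 / 2000) (LayeredHom (L : E3 →L[ℝ] E3) w) :=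
    hENall S hdoorP haff (hC₁q 1 S hdoorPG) η hη (hηle.trans (min_le_left _ _)) R ((le_max_left _ _).trans hRle) L w hchart Ψ hreg
  rw [← hQa] at hchart
  rw [← hQCg] at hreg
  obtain ⟨w', hlay, hcr, htm, hco⟩ := P.uts L w hchart hnear
  have hK : (Q.toK η R).OK := SBPre.ok_toK hQ hη (hηle.trans (min_le_right _ _)) ((le_max_right _ _).trans hRle)
  have hρ0 : 0 < ρ := lt_of_lt_of_le (lt_max_of_lt_right (by norm_num)) hρ
  have hxR : ‖x‖ < 8 * R := mem_ball_zero_iff.1 (hsub ⟨hx, mem_ball_self hρ0⟩)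
  have T := P.th hK hdoorP hdoorQ haff hchart hnear hlay hcr htm hco hreg hiso hcoh hx hxR
  have hfin := T.final (ρ := ρ) ((le_max_left _ _).trans hρ) ((le_max_right _ _).trans hρ) hsub
  rw [SBPre.ABK_toK hQ hη.le] at hfin
  exact hfin

/-- ★ [SBᵇ] at the literals of the column from the OPEN leaves (RC), (I4ˢ), hU, hN only — the SB-glue hypothesis of part XB's
`subWindowBudgetBPG_of_leaves` discharged by `subWindowBudgetGlueBPG_holds`. [this file, g59] -/
theorem subWindowBudgetBPG_of_open_leaves (hRC : EquilChartStrainP (1 / 25) 3 (1 / 1000)) (h4 : TailFluxBSP 1 3 (1 / 16) (1 / 25))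
    (hU : UniformTameStabilityE (1 / 50) 2 (1 / 2000)) (hN : EnergyNearChartPX 1 2 (1 / 16) (1 / 50) (1 / 2000)) :
    SubWindowBudgetBPG tameRadius 1 2 (1 / 16) (1 / 50) :=
  subWindowBudgetBPG_of_leaves subWindowBudgetGlueBPG_holds hRC h4 hU hN

/-- ★★ [CC°_Ψᵇ] at the literals from the Caccioppoli glue and the OPEN leaves (RC), (I4ˢ), hU, hN, [KS] (part XB's
`coherentGscCaccioppoliPsiBPG_of_leaves` with the SB-glue discharged). [this file, g59] -/
theorem coherentGscCaccioppoliPsiBPG_of_open_leaves (hglueC : CaccioppoliGlueBPG tameRadius 1 2 (1 / 16) (1 / 50) (1 / 2000))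
    (hRC : EquilChartStrainP (1 / 25) 3 (1 / 1000)) (h4 : TailFluxBSP 1 3 (1 / 16) (1 / 25)) (hU : UniformTameStabilityE (1 / 50) 2 (1 / 2000))
    (hN : EnergyNearChartPX 1 2 (1 / 16) (1 / 50) (1 / 2000)) (hKS : KornSobolevPoincareP 1 (1 / 16)) :
    CoherentGscCaccioppoliPsiBPG tameRadius 1 2 (1 / 16) (1 / 50) :=
  coherentGscCaccioppoliPsiBPG_of_leaves (by norm_num) (by norm_num) hglueC subWindowBudgetGlueBPG_holds hRC h4 hU hN hKS

/-- Record example: the docket of record (`strainNonConcentrationBPG_1_50_of_docketPsi`, part UN) at column `_16XH19B`'s literals with ONE HYPOTHESIS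
FEWER than part XB's record example — the SB-glue `SubWindowBudgetGlueBPG tameRadius 1 2 3 (1/16) (1/50) (1/25) (1/2000) (1/1000)` is now a theorem. -/
example (hG : Literature.Analysis.PDE.ZatorskaGoldstein2005_localGehringLemmaCounting)
    (hI : DressedCorePG tameRadius dressLevel dressLevel dressExponent 8 collarRadius clusterSize 1 2 (1 / 16) (1 / 50))
    (hTb : BareTameWindowBPG tameRadius dressLevel dressLevel dressExponent 8 collarRadius clusterSize 1 2 (1 / 16) (1 / 50))
    (hKS : KornSobolevPoincareP 1 (1 / 16)) (hW : CoherentWindowPsiBPG tameRadius 1 2 (1 / 16) (1 / 50))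
    (hglueC : CaccioppoliGlueBPG tameRadius 1 2 (1 / 16) (1 / 50) (1 / 2000))
    (hRC : EquilChartStrainP (1 / 25) 3 (1 / 1000)) (h4 : TailFluxBSP 1 3 (1 / 16) (1 / 25))
    (hU : UniformTameStabilityE (1 / 50) 2 (1 / 2000)) (hN : EnergyNearChartPX 1 2 (1 / 16) (1 / 50) (1 / 2000)) :
    StrainNonConcentrationBPG 1 2 (1 / 16) (1 / 50) :=
  strainNonConcentrationBPG_1_50_of_docketPsi hG hI hTb hKS hW (coherentGscCaccioppoliPsiBPG_of_open_leaves hglueC hRC h4 hU hN hKS)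

end Summit.AtomisticToContinuum.Crystallization.Theorems.ChartedZeroExcessLayeredLatticeLiouville

end
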